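import Summits.CriticalPhenomena.PercolationContinuityZ3.Theorems.Transplant.SectorSlabOwnCriticalPoint
import Summits.CriticalPhenomena.PercolationContinuityZ3.Theorems.Transplant.RationalHalfSlabDesign
import HarnessLib

/-!
# Sector-slabs of ARBITRARY REAL APERTURE `{x ∈ S_k | 0 ≤ x₂ ≤ s·x₁}` (`s > 0`, irrational slopes allowed): the station design

builds on p205010 (kernel theorem, internal audit signed; external expert review pending) — NOT used in this file.
Lane `prim-bschramm`, seat `prim-bschramm-p2` (gen 23; class C1b, METHOD = input substitution; memo `HOME/bschramm/P2-LATTICES.md` §78);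
helper file (`--supports stmt-CriticalPhenomena-4575 --as helper`).  The `m`-indexed design of `SectorSlabUniqueness` (aperture `arctan(1/m)`)
runs for EVERY real slope `s > 0` once an integer `m ≥ 1` with `m·s ≥ 1` is fixed: arms `steepSetM (2m)` (slope `1/(2m) ≤ s`) from `u + e₁` (top
face) and from `u + e₂` (right face — nonempty only when `s > 1`) stay inside the sector (`x₂ ≤ u₂ + (x₁−N−1)/(2m) ≤ sN + s(x₁−N−1) ≤ sx₁`); the
station `Ω = (0, Y, 0)`, `Y = m(4N+4)`, sweeps to `Z = 4N+4 ≤ sY`; top `T = Y + 2N + 2 = (4m+2)(N+1)`; both spreads are `≤ 3N+3` by cancelling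
`2m` (`2m(3N+3) ≥ 4m(N+1) + 2N + 2`); window `M = k + (4m+2)(N+1)`; `P ≥ α_{2m}·α`; `≤ k+1` edges.  No left or bottom face.
* `mem_rsec_iff`, `rsec_cyl`, **`rsec_innerBdry`**, `rsec_station_props`, **`rsec_vertex_design`**.
Sequel `RealSectorSlabRow`: `p_c = p_c(S_k)`, `θ(p_c) = 0`, `N ≤ 1` ∀p, `θ_v ∈ C[0,1]` at every vertex, for every real `s > 0`.
[cite: AizenmanChayesChayesFrohlichRusso1983, §4 Thm 4.4, Lemma 4.2 (a), Lemma 4.3] [cite: ChayesChayes1986Wedges, Thm. 1]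
[cite: DuminilCopinSidoraviciusTassion2016, Thm. 1 and §2] -/

noncomputable section

namespace Summit.CriticalPhenomena.PercolationContinuityZ3.Theorems.Transplant

namespace RealSectorSlab

open MeasureTheory Literature.Probability.Percolation Literature.Probability.LatticeModels SimpleGraph HSU OrthantUniq HalfSlabUniq
  ConeSlabUniq SectorSlab RationalHalfSlab Filter
open scoped Classical Topology

variable {k m : ℕ} {N : ℕ} {s : ℝ}

/-! ## §1 The sector-slab of real slope `s` -/

/-- Membership. [folklore] -/
theorem mem_rsec_iff {x : Site 3} :
    x ∈ {x : Site 3 | x ∈ slab 3 k ∧ (0 ≤ x 2 ∧ (x 2 : ℝ) ≤ s * (x 1 : ℝ))} ↔ (0 ≤ x 0 ∧ x 0 ≤ (k : ℤ)) ∧ (0 ≤ x 2 ∧ (x 2 : ℝ) ≤ s * (x 1 : ℝ)) :=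
  Iff.rfl

/-- The domain is cylindrical. [folklore] -/
theorem rsec_cyl : ∀ x ∈ {x : Site 3 | x ∈ slab 3 k ∧ (0 ≤ x 2 ∧ (x 2 : ℝ) ≤ s * (x 1 : ℝ))}, ∀ y ∈ slab 3 k, y 1 = x 1 → y 2 = x 2 →
    y ∈ {x : Site 3 | x ∈ slab 3 k ∧ (0 ≤ x 2 ∧ (x 2 : ℝ) ≤ s * (x 1 : ℝ))} := by
  intro x hx y hy h1 h2
  exact ⟨hy, by rw [h1, h2]; exact hx.2⟩

/-- The domain lies in the slab. [folklore] -/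
theorem rsec_subset_slab : {x : Site 3 | x ∈ slab 3 k ∧ (0 ≤ x 2 ∧ (x 2 : ℝ) ≤ s * (x 1 : ℝ))} ⊆ slab 3 k := fun _ hx => hx.1

/-- In the sector `x₁ ≥ 0` (`s > 0`). [folklore] -/
theorem nonneg_of_mem_rsec (hs : 0 < s) {x : Site 3} (hx : x ∈ {x : Site 3 | x ∈ slab 3 k ∧ (0 ≤ x 2 ∧ (x 2 : ℝ) ≤ s * (x 1 : ℝ))}) :
    0 ≤ x 1 := by
  obtain ⟨-, h2, h3⟩ := hx
  by_contra h
  push Not at h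
  have h' : (x 1 : ℝ) ≤ -1 := by exact_mod_cast (show x 1 ≤ -1 by omega)
  have h2' : (0 : ℝ) ≤ (x 2 : ℝ) := by exact_mod_cast h2
  nlinarith

/-- **Arms of slope `1/(2m)` stay inside the sector** (`m·s ≥ 1`, `s > 0`): if `0 ≤ x₂ − c₂`, `2m(x₂ − c₂) ≤ x₁ − c₁` with `c₁ ≤ x₁`... for a base
point `c` with `c₂ ≤ s·c₁` and `c₂ ≥ 0`, then `0 ≤ x₂` and `x₂ ≤ s·x₁`. [folklore] -/
theorem mem_rsec_of_arm (hs : 0 < s) (hms : 1 ≤ (m : ℝ) * s) {c x : Site 3} (hc2 : 0 ≤ c 2) (hcs : (c 2 : ℝ) ≤ s * (c 1 : ℝ))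
    (h1 : 0 ≤ x 2 - c 2) (h2 : 2 * (m : ℤ) * (x 2 - c 2) ≤ x 1 - c 1) (hx0 : x ∈ slab 3 k) :
    x ∈ {x : Site 3 | x ∈ slab 3 k ∧ (0 ≤ x 2 ∧ (x 2 : ℝ) ≤ s * (x 1 : ℝ))} := by
  refine ⟨hx0, by omega, ?_⟩
  have h1r : (0 : ℝ) ≤ (x 2 : ℝ) - (c 2 : ℝ) := by exact_mod_cast h1
  have h2r : 2 * (m : ℝ) * ((x 2 : ℝ) - (c 2 : ℝ)) ≤ (x 1 : ℝ) - (c 1 : ℝ) := by exact_mod_cast h2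
  have hm0 : (0 : ℝ) ≤ (m : ℝ) := by positivity
  have e1 : 0 ≤ (2 * (m : ℝ) * s - 1) * ((x 2 : ℝ) - (c 2 : ℝ)) := mul_nonneg (by nlinarith) h1r
  have e2 : 0 ≤ s * ((x 1 : ℝ) - (c 1 : ℝ) - 2 * (m : ℝ) * ((x 2 : ℝ) - (c 2 : ℝ))) := mul_nonneg hs.le (by linarith)
  nlinarith

/-- **Classification of the inner boundary of `[-N,N]³` in the real sector-slab** (`s > 0`, `N ≥ k+1`): top face `u₁ = N` (with `u + e₁` in the
domain) or right face `u₂ = N` (with `u + e₂` in the domain, hence `u₁ ≥ 1`); never the left or bottom face.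
[cite: AizenmanChayesChayesFrohlichRusso1983, §4 (4.26)] -/
theorem rsec_innerBdry (hs : 0 < s) (hN : k + 1 ≤ N) {u : Site 3} (hu : u ∈ boxSet 3 N)
    (hw : ∃ w, w ∉ boxSet 3 N ∧ (withinGraph (zdGraph 3) {x : Site 3 | x ∈ slab 3 k ∧ (0 ≤ x 2 ∧ (x 2 : ℝ) ≤ s * (x 1 : ℝ))}).Adj u w) :
    u ∈ {x : Site 3 | x ∈ slab 3 k ∧ (0 ≤ x 2 ∧ (x 2 : ℝ) ≤ s * (x 1 : ℝ))} ∧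
      (u 1 = N ∨ (u 2 = N ∧ u + Pi.single 2 1 ∈ {x : Site 3 | x ∈ slab 3 k ∧ (0 ≤ x 2 ∧ (x 2 : ℝ) ≤ s * (x 1 : ℝ))} ∧ 1 ≤ u 1)) := by
  obtain ⟨huD, hface⟩ := innerBdry_faces rsec_subset_slab hN hu hw
  refine ⟨huD, ?_⟩
  obtain ⟨-, hu2, hu3⟩ := (mem_rsec_iff (k := k)).1 huD
  rcases hface with ⟨h, -⟩ | ⟨h, hD⟩ | ⟨h, -⟩ | ⟨h, -⟩
  · exact Or.inl h
  · refine Or.inr ⟨h, hD, ?_⟩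
    obtain ⟨-, -, hD3⟩ := (mem_rsec_iff (k := k)).1 hD
    simp only [Pi.add_apply, Pi.single_eq_same, Pi.single_eq_of_ne (show (1 : Fin 3) ≠ 2 by decide), add_zero] at hD3
    rw [h] at hD3; push_cast at hD3
    by_contra hlt
    push Not at hlt
    have : (u 1 : ℝ) ≤ 0 := by exact_mod_cast (show u 1 ≤ 0 by omega)
    nlinarith
  · exfalso; omega
  · exfalso
    rw [h] at hu3; push_cast at hu3
    have : (0 : ℝ) ≤ (u 2 : ℝ) := by exact_mod_cast hu2
    have hN1 : (1 : ℝ) ≤ (N : ℝ) := by exact_mod_cast (show 1 ≤ N by omega)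
    nlinarith

/-! ## §2 The design -/

/-- **The station's region**: `Ω = (0, m(4N+4), 0)`, `Z = 4N+4`, `T = (4m+2)(N+1)` (`m ≥ 1`, `m·s ≥ 1`): inside the sector (`x₂ ≤ Z ≤ s·Y ≤ s·x₁`),
off the box, below `T`. [folklore] -/
theorem rsec_station_props (hs : 0 < s) (hm : 1 ≤ m) (hms : 1 ≤ (m : ℝ) * s) {x : Site 3}
    (hx : x ∈ shallowReg k ![0, (m : ℤ) * (4 * (N : ℤ) + 4), 0] (4 * (N : ℤ) + 4)) :
    x ∈ {x : Site 3 | x ∈ slab 3 k ∧ (0 ≤ x 2 ∧ (x 2 : ℝ) ≤ s * (x 1 : ℝ))} ∧ x ∉ boxSet 3 N ∧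
      x 1 ≤ (m : ℤ) * (4 * (N : ℤ) + 4) + 2 * (N : ℤ) + 2 := by
  obtain ⟨h0, h1, h2, h3, hZ⟩ := shallowReg_props hx
  simp only [Matrix.cons_val_one, Matrix.cons_val_zero, Matrix.cons_val] at h1 h2 h3
  have hmZ : (1 : ℤ) * (4 * (N : ℤ) + 4) ≤ (m : ℤ) * (4 * (N : ℤ) + 4) :=
    mul_le_mul_of_nonneg_right (by exact_mod_cast hm) (by positivity)
  have h1r : (m : ℝ) * (4 * (N : ℝ) + 4) ≤ (x 1 : ℝ) := by exact_mod_cast h1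
  have hZr : (x 2 : ℝ) ≤ 4 * (N : ℝ) + 4 := by exact_mod_cast hZ
  have e1 : s * ((m : ℝ) * (4 * (N : ℝ) + 4)) ≤ s * (x 1 : ℝ) := mul_le_mul_of_nonneg_left h1r hs.le
  have e2 : (1 : ℝ) * (4 * (N : ℝ) + 4) ≤ ((m : ℝ) * s) * (4 * (N : ℝ) + 4) := mul_le_mul_of_nonneg_right hms (by positivity)
  refine ⟨⟨h0, h3, by nlinarith⟩, not_mem_boxSet_of_lt (j := 1) (by rw [abs_of_nonneg (by omega)]; omega), by omega⟩

/-- **The design at an inner-boundary vertex of the real sector-slab** (`s > 0`, `m ≥ 1`, `m·s ≥ 1`, `N ≥ k+1`; `α₂` an arm bound of slope `1/(2m)`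
and `A` a slab arm kit at `p'`): an increasing event, measurable, determined by the edges of `[-M,M]³` (`M = k + (4m+2)(N+1)`), of `P_{p'} ≥ α₂·α`,
on which `≤ k+1` extra open edges join `u` to the station `Ω = (0, m(4N+4), 0)` through open exterior steps of the sector-slab.
[cite: AizenmanChayesChayesFrohlichRusso1983, §4 Cor. to Lemma 4.3, Lemma 4.2 (a)] -/
theorem rsec_vertex_design (hs : 0 < s) (hm : 1 ≤ m) (hms : 1 ≤ (m : ℝ) * s) (hN : k + 1 ≤ N) {p' : unitInterval} (A : SlabArmKit k p')
    {α₂ : ℝ} (hα₂ : 0 < α₂)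
    (harm : ∀ b : Site 3, b ∈ slab 3 k →
      α₂ ≤ (bondPercolation (zdGraph 3) p').real (percolatesVia (withinGraph (zdGraph 3) (steepSetM (2 * m) k 1 b)) b))
    {u : Site 3} (hu : u ∈ boxSet 3 N)
    (hw : ∃ w, w ∉ boxSet 3 N ∧ (withinGraph (zdGraph 3) {x : Site 3 | x ∈ slab 3 k ∧ (0 ≤ x 2 ∧ (x 2 : ℝ) ≤ s * (x 1 : ℝ))}).Adj u w) :
    ∃ E : Set (BondConfig (Site 3)), IsUpperSet E ∧ MeasurableSet E ∧ DeterminedBy E ↑(edgesIn (zdGraph 3) (box 3 (k + (4 * m + 2) * (N + 1)))) ∧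
      α₂ * A.α ≤ (bondPercolation (zdGraph 3) p').real E ∧
      ∀ ω ∈ E, ∃ F : Finset (Sym2 (Site 3)), F ⊆ edgesIn (zdGraph 3) (box 3 (k + (4 * m + 2) * (N + 1))) ∧ F.card ≤ k + 1 ∧
        ω ∪ ↑F ∈ openConnVia (starGraph (withinGraph (zdGraph 3) {x : Site 3 | x ∈ slab 3 k ∧ (0 ≤ x 2 ∧ (x 2 : ℝ) ≤ s * (x 1 : ℝ))}) Set.univ
          (boxSet 3 N)) u ![0, (m : ℤ) * (4 * (N : ℤ) + 4), 0] := by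
  obtain ⟨huP, hface⟩ := rsec_innerBdry hs hN hu hw
  obtain ⟨hu0, hu2, hu3⟩ := (mem_rsec_iff (k := k)).1 huP
  have hub := mem_boxSet_iff.1 hu
  have hu1 := hub 1; have hu2b := hub 2
  have hm1 : (1 : ℤ) ≤ (m : ℤ) := by exact_mod_cast hm
  have h2m0 : (0 : ℤ) < 2 * (m : ℤ) := by linarith
  -- constants
  obtain ⟨Y, hY⟩ : ∃ Y : ℤ, Y = (m : ℤ) * (4 * (N : ℤ) + 4) := ⟨_, rfl⟩
  obtain ⟨T, hT⟩ : ∃ T : ℤ, T = Y + 2 * (N : ℤ) + 2 := ⟨_, rfl⟩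
  have hYlo : 4 * (N : ℤ) + 4 ≤ Y := by
    have h := mul_le_mul_of_nonneg_right hm1 (show (0 : ℤ) ≤ 4 * (N : ℤ) + 4 by positivity)
    rw [hY]; linarith
  have hTcast : ((k + (4 * m + 2) * (N + 1) : ℕ) : ℤ) = (k : ℤ) + T := by push_cast; rw [hT, hY]; ring
  set Ω : Site 3 := ![0, (m : ℤ) * (4 * (N : ℤ) + 4), 0] with hΩ_def
  have hΩ0 : Ω 0 = 0 := by simp [hΩ_def]
  have hΩ1 : Ω 1 = Y := by simp [hΩ_def, hY]
  have hΩ2 : Ω 2 = 0 := by simp [hΩ_def]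
  have hΩslab : Ω ∈ slab 3 k := by show 0 ≤ Ω 0 ∧ Ω 0 ≤ (k : ℤ); rw [hΩ0]; exact ⟨le_rfl, by positivity⟩
  have hH : ∀ x ∈ shallowReg k Ω (4 * (N : ℤ) + 4), x ∈ {x : Site 3 | x ∈ slab 3 k ∧ (0 ≤ x 2 ∧ (x 2 : ℝ) ≤ s * (x 1 : ℝ))} ∧ x ∉ boxSet 3 N ∧
      x 1 ≤ T := fun x hx => by rw [hT, hY]; exact rsec_station_props hs hm hms hx
  have hwinH : ∀ x ∈ shallowReg k Ω (4 * (N : ℤ) + 4), ∀ j, |x j| ≤ (k + (4 * m + 2) * (N + 1) : ℕ) := by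
    intro x hx j
    rw [hTcast]
    obtain ⟨h0, h1, h2, h3, hZ⟩ := shallowReg_props hx
    rw [hΩ1] at h1 h2; rw [hΩ2] at h2 h3
    fin_cases j <;> rw [abs_le] <;> constructor <;> simp <;> linarith
  -- generic packaging: apex `b ∈ S_k` in the domain with `1 ≤ b₁ ≤ N+1`, `0 ≤ b₂ ≤ N+1`; arm `steepSetM (2m) k 1 b`; escape `{u, b}`
  have pack : ∀ {b : Site 3} (_ : b ∈ {x : Site 3 | x ∈ slab 3 k ∧ (0 ≤ x 2 ∧ (x 2 : ℝ) ≤ s * (x 1 : ℝ))}) (_ : 1 ≤ b 1) (_ : b 1 ≤ (N : ℤ) + 1)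
      (_ : b 2 ≤ (N : ℤ) + 1) (_ : (zdGraph 3).Adj u b) (_ : b ∉ boxSet 3 N)
      (_ : ∀ x ∈ steepSetM (2 * m) k 1 b ∩ {x | x 1 ≤ T}, x ∉ boxSet 3 N),
      ∃ E : Set (BondConfig (Site 3)), IsUpperSet E ∧ MeasurableSet E ∧ DeterminedBy E ↑(edgesIn (zdGraph 3) (box 3 (k + (4 * m + 2) * (N + 1)))) ∧
        α₂ * A.α ≤ (bondPercolation (zdGraph 3) p').real E ∧
        ∀ ω ∈ E, ∃ F : Finset (Sym2 (Site 3)), F ⊆ edgesIn (zdGraph 3) (box 3 (k + (4 * m + 2) * (N + 1))) ∧ F.card ≤ k + 1 ∧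
          ω ∪ ↑F ∈ openConnVia (starGraph (withinGraph (zdGraph 3) {x : Site 3 | x ∈ slab 3 k ∧ (0 ≤ x 2 ∧ (x 2 : ℝ) ≤ s * (x 1 : ℝ))}) Set.univ
            (boxSet 3 N)) u Ω := by
    intro b hbP hb1lo hb1hi hb2hi hadj hbbox hSbox
    obtain ⟨hbslab, hb2, hb3⟩ := (mem_rsec_iff (k := k)).1 hbP
    set S : Set (Site 3) := steepSetM (2 * m) k 1 b ∩ {x | x 1 ≤ T} with hS_def
    have hbS : b ∈ S := ⟨self_mem_steepSetM hbslab, by show b 1 ≤ T; linarith⟩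
    have hSprops : ∀ x ∈ S, (0 ≤ x 0 ∧ x 0 ≤ (k : ℤ)) ∧ b 1 ≤ x 1 ∧ x 1 ≤ T ∧ b 2 ≤ x 2 ∧ x 2 ≤ b 2 + 3 * (N : ℤ) + 3 ∧
        x ∈ {x : Site 3 | x ∈ slab 3 k ∧ (0 ≤ x 2 ∧ (x 2 : ℝ) ≤ s * (x 1 : ℝ))} := by
      rintro x ⟨⟨h0, h1, h2⟩, hxT⟩
      have hxT' : x 1 ≤ T := hxT
      rw [one_mul] at h1 h2
      push_cast at h2
      have hA : (0 : ℤ) ≤ 2 * (m : ℤ) * (x 2 - b 2) := mul_nonneg h2m0.le h1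
      have hsp : x 2 - b 2 ≤ 3 * (N : ℤ) + 3 := by
        refine le_of_mul_le_mul_left ?_ h2m0
        calc 2 * (m : ℤ) * (x 2 - b 2) ≤ x 1 - b 1 := h2
          _ ≤ T - 1 := by linarith
          _ ≤ 2 * (m : ℤ) * (3 * (N : ℤ) + 3) := by rw [hT, hY]; nlinarith
      exact ⟨h0, by linarith, hxT', by linarith, by linarith, mem_rsec_of_arm hs hms hb2 hb3 h1 h2 h0⟩
    have hSz : ∀ x ∈ S, Ω 2 ≤ x 2 ∧ x 2 ≤ 4 * (N : ℤ) + 4 := fun x hx => by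
      obtain ⟨-, -, -, h3, h4, -⟩ := hSprops x hx
      rw [hΩ2]; exact ⟨hb2.trans h3, by linarith⟩
    have hSD : ∀ x ∈ S, x ∈ {x : Site 3 | x ∈ slab 3 k ∧ (0 ≤ x 2 ∧ (x 2 : ℝ) ≤ s * (x 1 : ℝ))} ∧ x ∉ boxSet 3 N := fun x hx =>
      ⟨(hSprops x hx).2.2.2.2.2, hSbox x hx⟩
    have hM : ∀ x ∈ S ∪ shallowReg k Ω (4 * (N : ℤ) + 4), ∀ j, |x j| ≤ (k + (4 * m + 2) * (N + 1) : ℕ) := by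
      rintro x (hx | hx) j
      · rw [hTcast]
        obtain ⟨h0, h1, h2, h3, h4, -⟩ := hSprops x hx
        fin_cases j <;> rw [abs_le] <;> constructor <;> simp <;> linarith
      · exact hwinH x hx j
    set E : Set (BondConfig (Site 3)) := reachEvent (withinGraph (zdGraph 3) S) b {x | x 1 = T} ∩
      reachEvent (withinGraph (zdGraph 3) (shallowReg k Ω (4 * (N : ℤ) + 4))) Ω {x | x 2 = 4 * (N : ℤ) + 4} with hE
    have hSfin : S.Finite := (boxSet_finite _).subset (subset_boxSet_of_abs_le fun x hx => hM x (Or.inl hx))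
    have hprobS : α₂ ≤ (bondPercolation (zdGraph 3) p').real (reachEvent (withinGraph (zdGraph 3) S) b {x | x 1 = T}) :=
      le_real_of_subset (percolatesVia_subset_reachEvent_le (self_mem_steepSetM hbslab) 1 (by linarith)
        (by simpa [hS_def] using hSfin)) (harm b hbslab)
    have hprobH : A.α ≤ (bondPercolation (zdGraph 3) p').real
        (reachEvent (withinGraph (zdGraph 3) (shallowReg k Ω (4 * (N : ℤ) + 4))) Ω {x | x 2 = 4 * (N : ℤ) + 4}) :=
      le_real_of_subset (percolatesVia_subset_reachEvent_le (self_mem_shallowSet hΩslab) 2 (by rw [hΩ2]; positivity)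
        (by simpa only [HalfSlabUniq.shallowReg] using shallowReg_finite (k := k) Ω (4 * (N : ℤ) + 4))) (A.shallow_arm Ω hΩslab)
    refine ⟨E, (isUpperSet_reachEvent _ _ _).inter (isUpperSet_reachEvent _ _ _),
      (measurableSet_reachEvent _ _ _).inter (measurableSet_reachEvent _ _ _), ?_, ?_, fun ω hω => ?_⟩
    · exact ((determinedBy_reachEvent _ _ _).mono (edgeSet_withinGraph_subset_edgesIn (subset_boxSet_of_abs_le fun x hx =>
        hM x (Or.inl hx)))).inter ((determinedBy_reachEvent _ _ _).mono (edgeSet_withinGraph_subset_edgesIn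
          (subset_boxSet_of_abs_le fun x hx => hM x (Or.inr hx))))
    · exact harris2_of_le p' (isUpperSet_reachEvent _ _ _) (isUpperSet_reachEvent _ _ _) (measurableSet_reachEvent _ _ _)
        (measurableSet_reachEvent _ _ _) hα₂.le hprobS hprobH
    · obtain ⟨F, hFs, hFc, hFr⟩ := move_apex_cyl_region (D := {x : Site 3 | x ∈ slab 3 k ∧ (0 ≤ x 2 ∧ (x 2 : ℝ) ≤ s * (x 1 : ℝ))}) (by omega)
        rsec_cyl (S := S) (fun x hx => (hSprops x hx).1) hbS hΩslab (by rw [hΩ2]; positivity) (by rw [hΩ1]; linarith)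
        (fun x hx => ⟨(hSD x hx).1, (hSD x hx).2, ⟨(hSprops x hx).2.1, (hSprops x hx).2.2.1⟩, hSz x hx⟩) hH hM hω
      have hMN : N ≤ k + (4 * m + 2) * (N + 1) := by nlinarith
      have hwu : ∀ j, |u j| ≤ (k + (4 * m + 2) * (N + 1) : ℕ) := abs_le_of_mem_boxSet hu hMN
      have hwb : ∀ j, |b j| ≤ (k + (4 * m + 2) * (N + 1) : ℕ) := hM b (Or.inl hbS)
      refine ⟨insert s(u, b) F, ?_, (Finset.card_insert_le _ _).trans (by omega), ?_⟩
      · intro e he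
        rcases Finset.mem_insert.1 he with rfl | he
        · exact mem_edgesIn_of_adj hadj hwu hwb
        · exact hFs he
      · exact openConnVia_step (dext_adj_of hadj huP hbP fun h' => hbbox h'.2) (Finset.mem_insert_self _ _)
          (openConnVia_mono_finset (Finset.subset_insert _ _) hFr)
  rcases hface with htop | ⟨hright, hbD, hu1pos⟩
  · -- TOP face: escape `u → b = u + e₁`; in the domain since `u₂ ≤ sN ≤ s(N+1)`
    set b : Site 3 := u + Pi.single 1 1 with hb_def
    have hb0 : b 0 = u 0 := by simp [hb_def]
    have hb1 : b 1 = (N : ℤ) + 1 := by simp [hb_def, htop]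
    have hb2 : b 2 = u 2 := by simp [hb_def]
    rw [htop] at hu3; push_cast at hu3
    have hbP : b ∈ {x : Site 3 | x ∈ slab 3 k ∧ (0 ≤ x 2 ∧ (x 2 : ℝ) ≤ s * (x 1 : ℝ))} := by
      refine ⟨by show 0 ≤ b 0 ∧ b 0 ≤ (k : ℤ); rw [hb0]; exact hu0, by rw [hb2]; exact hu2, ?_⟩
      rw [hb2, hb1]; push_cast; nlinarith
    refine pack hbP (by rw [hb1]; omega) (by rw [hb1]) (by rw [hb2]; omega) ((zdGraph_adj_iff _ _).2 ⟨1, Or.inl rfl⟩)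
      (not_mem_boxSet_of_lt (j := 1) (by rw [hb1, abs_of_nonneg (by omega)]; omega)) fun x hx => ?_
    obtain ⟨⟨-, h1, h2⟩, -⟩ := hx
    rw [one_mul, hb2] at h1; rw [one_mul, hb2, hb1] at h2
    push_cast at h2
    have : (0 : ℤ) ≤ 2 * (m : ℤ) * (x 2 - u 2) := mul_nonneg h2m0.le h1
    exact not_mem_boxSet_of_lt (j := 1) (by rw [abs_of_nonneg (by linarith)]; linarith)
  · -- RIGHT face (`s > 1` only): escape `u → b = u + e₂`, in the domain by the boundary condition
    set b : Site 3 := u + Pi.single 2 1 with hb_def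
    have hb0 : b 0 = u 0 := by simp [hb_def]
    have hb1 : b 1 = u 1 := by simp [hb_def]
    have hb2 : b 2 = (N : ℤ) + 1 := by simp [hb_def, hright]
    refine pack hbD (by rw [hb1]; exact hu1pos) (by rw [hb1]; omega) (by rw [hb2]) ((zdGraph_adj_iff _ _).2 ⟨2, Or.inl rfl⟩)
      (not_mem_boxSet_of_lt (j := 2) (by rw [hb2, abs_of_nonneg (by omega)]; omega)) fun x hx => ?_
    obtain ⟨⟨-, h1, -⟩, -⟩ := hx
    rw [one_mul, hb2] at h1
    exact not_mem_boxSet_of_lt (j := 2) (by rw [abs_of_nonneg (by linarith)]; linarith)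

end RealSectorSlab

end Summit.CriticalPhenomena.PercolationContinuityZ3.Theorems.Transplant

end
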